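import Literature.Topology.FourManifolds.BordismFourProofs
import Literature.Topology.FourManifolds.BordismFourDisjointUnion
import Literature.AlgebraicTopology.SingularHomology.BoundaryClassGenerator
import Literature.AlgebraicTopology.SingularHomology.FundamentalClassExistence
import Literature.AlgebraicTopology.SingularHomology.FundamentalClassProofs
import HarnessLib

/-!
# A relative fundamental class of a cobordism induces orientations of its two ends

Topic `Literature/Topology/FourManifolds` (barrier seat
`provefact-Literature.Barriers.SmoothPoincare4.Stab-ad8c696e34`; step C of the level-parity
programme of `HCobordismLevelParity.lean`, usable wherever the tree's homological bordism data
`∂w = (inl)_*[M]_μ − (inr)_*[N]_ν` (`IsOrientedBordant`, `Cobordism.intersectionForm_self_eq_of_mem_boundaryImage`,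
`two_mul_boundaryImageRank_eq`) must be produced from a `ℤ`-orientation of the cobordism).

Hatcher, *Algebraic Topology* (2002), §3.3, p. 253: "an orientation of `M` determines an
orientation of `∂M`", and Spanier, *Algebraic Topology* (1981), Ch. 6 §3, Cor. 10: the connecting
homomorphism takes a fundamental class of `(X, Ẋ)` to a fundamental class of `Ẋ`.  For a cobordism
`W` from `M` to `N` between closed connected manifolds, `∂W ≅ M ⊔ N`
(`Cobordism.boundaryHomeomorph`) and `Hₙ(M ⊔ N) = Hₙ(M) ⊕ Hₙ(N)` (Hatcher Prop. 2.6, the tree's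
`singularHomology.sumMap_bijective`), so `∂z` splits into classes of `M` and of `N`, each a local
generator everywhere (Spanier Cor. 6.3.10, the tree's
`isGenerator_toLocal_δ_of_isRelFundamentalClass_holds_of_ne_zero`; local homology is invariant
under the open embeddings involved), hence each `±` the fundamental class of any given
orientation (Hatcher Thm. 3.26: `Hₙ(M) → Hₙ(M | x)` is an isomorphism for `M` closed connected
oriented, the tree's `singularHomology.isIso_toLocal_of_orientation`).  PROVED here:

* `eq_fundamentalClass_or_eq_neg_of_isGenerator_toLocal` — on a closed connected `ℤ`-oriented
  manifold, a class of `Hₙ(M; ℤ)` whose local image at one point is a generator is `±[M]`;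
* `Cobordism.exists_orientations_δ_eq` — **for a cobordism `c` from `M` to `N` between closed
  connected orientable manifolds (`n ≠ 0`) and a relative fundamental class `z` of
  `(c.W, ∂ c.W)`, there are orientations `μ = ±μ₀`, `ν = ±ν₀` of the ends with
  `∂z = (inl)_*[M]_μ − (inr)_*[N]_ν`**, i.e. `(c, z)` is an oriented bordism from `(M, μ)` to
  `(N, ν)` in the sense of `IsOrientedBordant`.

No named fact is introduced.

## References

* A. Hatcher, *Algebraic Topology*, CUP 2002, Prop. 2.6, Thm. 3.26, §3.3 p. 253.
  [HatcherAT2002]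
* E. H. Spanier, *Algebraic Topology*, Springer 1981, Ch. 6 §3, Cor. 10. [Spanier1981]
-/

noncomputable section

open scoped Manifold
open Set CategoryTheory Topology Literature.AlgebraicTopology.SingularHomology
open Literature.AlgebraicTopology.SingularHomology.SingularSimplex (sumInl sumInr)

universe u

namespace Literature.Topology.FourManifolds

/-! ### Classes which are local generators on a closed connected oriented manifold -/

section Closed

variable {n : ℕ} {X : Type u} [TopologicalSpace X] [CompactSpace X] [T2Space X]
  [ChartedSpace (EuclideanSpace ℝ (Fin n)) X] [ConnectedSpace X]

/-- **A top-dimensional class which is a local generator at one point is `±` the fundamental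
class** (Hatcher 2002, Thm. 3.26(a),(b): for `X` closed connected `ℤ`-oriented,
`Hₙ(X; ℤ) → Hₙ(X | x; ℤ) ≅ ℤ` is an isomorphism taking `[X]` to the local orientation `μₓ`; a
generator of `Hₙ(X | x; ℤ) ≅ ℤ` is `±μₓ`). [cite: HatcherAT2002, Thm. 3.26] -/
theorem eq_fundamentalClass_or_eq_neg_of_isGenerator_toLocal (μ : HomologicalOrientation ℤ X n)
    (u : singularHomology ℤ ℤ X n) (x : X)
    (hu : ∃ e : localHomology ℤ ℤ X x n ≃ₗ[ℤ] ℤ, e (singularHomology.toLocal ℤ ℤ x n u) = 1) :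
    u = μ.fundamentalClass ∨ u = -μ.fundamentalClass := by
  obtain ⟨e₀, he₀⟩ := μ.isGenerator x
  have hunit : IsUnit (e₀ (singularHomology.toLocal ℤ ℤ x n u)) :=
    isUnit_apply_of_exists_linearEquiv_apply_eq_one hu e₀
  have hfund : singularHomology.toLocal ℤ ℤ x n μ.fundamentalClass = μ.localClass x :=
    HomologicalOrientation.isFundamentalClass_fundamentalClass_holds (R := ℤ) (X := X) n μ x
  have hinj := singularHomology.toLocal_injective_of_connectedSpace_holds ℤ ℤ X n x
  rcases Int.isUnit_iff.1 hunit with h1 | h1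
  · left
    apply hinj
    rw [hfund]
    exact e₀.injective (h1.trans he₀.symm)
  · right
    apply hinj
    rw [map_neg, hfund]
    exact e₀.injective (by rw [h1, map_neg, he₀])

end Closed

/-! ### The ends of a `ℤ`-oriented cobordism -/

section Cobordism

variable {n : ℕ} {M N : Type u}
  [TopologicalSpace M] [CompactSpace M] [T2Space M] [ChartedSpace (EuclideanSpace ℝ (Fin n)) M]
  [ConnectedSpace M]
  [TopologicalSpace N] [CompactSpace N] [T2Space N] [ChartedSpace (EuclideanSpace ℝ (Fin n)) N]
  [ConnectedSpace N]

/-- **A relative fundamental class of a cobordism orients its ends** (Hatcher 2002, §3.3 p. 253;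
Spanier 1981, Cor. 6.3.10).  For a cobordism `c` from `M` to `N` between closed connected
manifolds of dimension `n ≠ 0` carrying orientations `μ₀`, `ν₀`, and a relative fundamental class
`z ∈ Hₙ₊₁(W, ∂W; ℤ)` (`IsRelFundamentalClass`), there are orientations `μ ∈ {μ₀, −μ₀}` of `M` and
`ν ∈ {ν₀, −ν₀}` of `N` with `∂z = (inl)_*[M]_μ − (inr)_*[N]_ν` in `Hₙ(∂W; ℤ)`: transport `∂z`
along `∂W ≅ M ⊔ N`, split it as `inl_* u + inr_* v` (Hatcher Prop. 2.6), observe that `u`, `v`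
are local generators (because `∂z` is, Spanier Cor. 6.3.10, and local homology is invariant
under the open embeddings `M → M ⊔ N ≅ ∂W`), hence `u = ±[M]_{μ₀}`, `v = ±[N]_{ν₀}` (Hatcher
Thm. 3.26), and absorb the signs into the orientations (`[X]_{−μ} = −[X]_μ`).
[cite: HatcherAT2002, §3.3 p. 253 and Thm. 3.26] [cite: Spanier1981, Ch. 6 Sec. 3 Cor. 10] -/
theorem Cobordism.exists_orientations_δ_eq (hn : n ≠ 0) (c : Cobordism n M N)
    (μ₀ : HomologicalOrientation ℤ M n) (ν₀ : HomologicalOrientation ℤ N n)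
    {z : relativeSingularHomology ℤ ℤ c.W ((𝓡∂ (n + 1)).boundary c.W) (n + 1)}
    (hz : IsRelFundamentalClass ℤ ((𝓡∂ (n + 1)).boundary c.W) z) :
    ∃ (μ : HomologicalOrientation ℤ M n) (ν : HomologicalOrientation ℤ N n),
      (μ = μ₀ ∨ μ = -μ₀) ∧ (ν = ν₀ ∨ ν = -ν₀) ∧
      relativeSingularHomology.δ ℤ ℤ c.W ((𝓡∂ (n + 1)).boundary c.W) n z =
        singularHomology.map ℤ ℤ c.inlBoundary n μ.fundamentalClass -
          singularHomology.map ℤ ℤ c.inrBoundary n ν.fundamentalClass := by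
  -- transport `∂z` to `Hₙ(M ⊔ N)` along `∂W ≅ M ⊔ N` and split it
  have hed : singularHomology.map ℤ ℤ (c.boundaryHomeomorph : C(M ⊕ N, ↥((𝓡∂ (n + 1)).boundary c.W))) n
      (singularHomology.map ℤ ℤ
        (c.boundaryHomeomorph.symm : C(↥((𝓡∂ (n + 1)).boundary c.W), M ⊕ N)) n
        (relativeSingularHomology.δ ℤ ℤ c.W ((𝓡∂ (n + 1)).boundary c.W) n z)) =
      relativeSingularHomology.δ ℤ ℤ c.W ((𝓡∂ (n + 1)).boundary c.W) n z := by
    rw [← ModuleCat.comp_apply, ← singularHomology.map_comp]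
    have : (c.boundaryHomeomorph : C(M ⊕ N, ↥((𝓡∂ (n + 1)).boundary c.W))).comp
        (c.boundaryHomeomorph.symm : C(↥((𝓡∂ (n + 1)).boundary c.W), M ⊕ N)) =
        ContinuousMap.id _ :=
      ContinuousMap.ext fun x => c.boundaryHomeomorph.apply_symm_apply x
    rw [this, singularHomology.map_id, ModuleCat.id_apply]
  obtain ⟨⟨u, v⟩, huv⟩ := (singularHomology.sumMap_bijective (R := ℤ) (M := ℤ) (X := M) (Y := N) n).2
    (singularHomology.map ℤ ℤ
      (c.boundaryHomeomorph.symm : C(↥((𝓡∂ (n + 1)).boundary c.W), M ⊕ N)) n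
      (relativeSingularHomology.δ ℤ ℤ c.W ((𝓡∂ (n + 1)).boundary c.W) n z))
  rw [singularHomology.sumMap_apply] at huv
  -- `∂z` is a local generator at every boundary point (Spanier Cor. 6.3.10) ...
  have hgen := isGenerator_toLocal_δ_of_isRelFundamentalClass_holds_of_ne_zero ℤ hn z hz
  -- ... hence so is its transport, at the points of `M ⊔ N`
  have hgen_d : ∀ p : M ⊕ N, ∃ f : localHomology ℤ ℤ (M ⊕ N) p n ≃ₗ[ℤ] ℤ,
      f (singularHomology.toLocal ℤ ℤ p n (singularHomology.map ℤ ℤ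
        (c.boundaryHomeomorph.symm : C(↥((𝓡∂ (n + 1)).boundary c.W), M ⊕ N)) n
        (relativeSingularHomology.δ ℤ ℤ c.W ((𝓡∂ (n + 1)).boundary c.W) n z))) = 1 := by
    intro p
    have hmaps : MapsTo (c.boundaryHomeomorph.symm : C(↥((𝓡∂ (n + 1)).boundary c.W), M ⊕ N))
        ({c.boundaryHomeomorph p}ᶜ : Set ↥((𝓡∂ (n + 1)).boundary c.W)) ({p}ᶜ : Set (M ⊕ N)) := by
      intro q hq hq'
      exact hq (by rw [← hq']; exact (c.boundaryHomeomorph.apply_symm_apply q).symm)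
    have hp : (c.boundaryHomeomorph.symm : C(↥((𝓡∂ (n + 1)).boundary c.W), M ⊕ N))
        (c.boundaryHomeomorph p) = p :=
      c.boundaryHomeomorph.symm_apply_apply p
    rw [singularHomology.toLocal_map_apply ℤ ℤ
      (c.boundaryHomeomorph.symm : C(↥((𝓡∂ (n + 1)).boundary c.W), M ⊕ N))
      (c.boundaryHomeomorph p) p hmaps n]
    haveI : IsIso (relativeSingularHomology.map ℤ ℤ
        (c.boundaryHomeomorph.symm : C(↥((𝓡∂ (n + 1)).boundary c.W), M ⊕ N)) hmaps n) := by
      have h := localHomology.isIso_map_of_isOpenEmbedding ℤ ℤ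
        (c.boundaryHomeomorph.symm : C(↥((𝓡∂ (n + 1)).boundary c.W), M ⊕ N))
        c.boundaryHomeomorph.symm.isOpenEmbedding (c.boundaryHomeomorph p)
      rw [hp] at h
      exact h hmaps n
    exact (exists_linearEquiv_apply_eq_one_iff_of_isIso _ _).2 (hgen (c.boundaryHomeomorph p))
  -- `u` is a local generator on `M`, `v` on `N`
  have hgen_u : ∀ x : M, ∃ f : localHomology ℤ ℤ M x n ≃ₗ[ℤ] ℤ,
      f (singularHomology.toLocal ℤ ℤ x n u) = 1 := by
    intro x
    have h := hgen_d (Sum.inl x)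
    rw [← huv, map_add,
      singularHomology.toLocal_map_apply ℤ ℤ (sumInl M N) x (Sum.inl x) (mapsTo_inl_compl_singleton x) n,
      singularHomology.toLocal_map_eq_zero_of_forall_ne ℤ ℤ (sumInr M N) (Sum.inl x)
        (fun _ => Sum.inr_ne_inl) n, add_zero] at h
    haveI := isIso_localHomology_map_inl ℤ (Y := N) x n
    exact (exists_linearEquiv_apply_eq_one_iff_of_isIso _ _).1 h
  have hgen_v : ∀ y : N, ∃ f : localHomology ℤ ℤ N y n ≃ₗ[ℤ] ℤ,
      f (singularHomology.toLocal ℤ ℤ y n v) = 1 := by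
    intro y
    have h := hgen_d (Sum.inr y)
    rw [← huv, map_add,
      singularHomology.toLocal_map_eq_zero_of_forall_ne ℤ ℤ (sumInl M N) (Sum.inr y)
        (fun _ => Sum.inl_ne_inr) n,
      singularHomology.toLocal_map_apply ℤ ℤ (sumInr M N) y (Sum.inr y) (mapsTo_inr_compl_singleton y) n,
      zero_add] at h
    haveI := isIso_localHomology_map_inr ℤ (X := M) y n
    exact (exists_linearEquiv_apply_eq_one_iff_of_isIso _ _).1 h
  -- hence `u = ±[M]`, `v = ±[N]`
  obtain ⟨x₀⟩ := (inferInstance : Nonempty M)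
  obtain ⟨y₀⟩ := (inferInstance : Nonempty N)
  have hu := eq_fundamentalClass_or_eq_neg_of_isGenerator_toLocal μ₀ u x₀ (hgen_u x₀)
  have hv := eq_fundamentalClass_or_eq_neg_of_isGenerator_toLocal ν₀ v y₀ (hgen_v y₀)
  -- `∂z = (inl)_* u + (inr)_* v`
  have hinl : (c.boundaryHomeomorph : C(M ⊕ N, ↥((𝓡∂ (n + 1)).boundary c.W))).comp (sumInl M N) =
      c.inlBoundary :=
    ContinuousMap.ext fun x => c.boundaryHomeomorph_inl x
  have hinr : (c.boundaryHomeomorph : C(M ⊕ N, ↥((𝓡∂ (n + 1)).boundary c.W))).comp (sumInr M N) =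
      c.inrBoundary :=
    ContinuousMap.ext fun y => c.boundaryHomeomorph_inr y
  have hδ : relativeSingularHomology.δ ℤ ℤ c.W ((𝓡∂ (n + 1)).boundary c.W) n z =
      singularHomology.map ℤ ℤ c.inlBoundary n u + singularHomology.map ℤ ℤ c.inrBoundary n v := by
    rw [← hed, ← huv, map_add, ← ModuleCat.comp_apply, ← ModuleCat.comp_apply,
      ← singularHomology.map_comp, ← singularHomology.map_comp, hinl, hinr]
  have hnegM := HomologicalOrientation.fundamentalClass_neg_holds ℤ M n μ₀
  have hnegN := HomologicalOrientation.fundamentalClass_neg_holds ℤ N n ν₀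
  -- choose the signs
  rcases hu with hu | hu <;> rcases hv with hv | hv
  · refine ⟨μ₀, -ν₀, Or.inl rfl, Or.inr rfl, ?_⟩
    rw [hδ, hu, hv, hnegN, map_neg, sub_neg_eq_add]
  · refine ⟨μ₀, ν₀, Or.inl rfl, Or.inl rfl, ?_⟩
    rw [hδ, hu, hv, map_neg, sub_eq_add_neg]
  · refine ⟨-μ₀, -ν₀, Or.inr rfl, Or.inr rfl, ?_⟩
    rw [hδ, hu, hv, hnegM, hnegN, map_neg, map_neg, sub_neg_eq_add]
  · refine ⟨-μ₀, ν₀, Or.inr rfl, Or.inl rfl, ?_⟩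
    rw [hδ, hu, hv, hnegM, map_neg, map_neg, sub_eq_add_neg]

end Cobordism

end Literature.Topology.FourManifolds

end
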